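import Literature.NumberTheory.LFunctions.WeilCombNodeWeightsSparse
import HarnessLib

/-!
# Node weights of `ζ`-mollified combs, IV: the four ranges of one term

Topic `Literature/NumberTheory/LFunctions`.  The node weight of the autocorrelation of a
`ζ`-mollified resonator comb at the node `log n` is, pair by pair `(ℓ, ℓ')` of resonator indices,
`n^{-1/2} ∑_{k' ≤ M} k'^{-1/2} S(log(nℓ'k'/ℓ))` with the tooth sum
`S(c) = ∑_{k ≤ M} k^{-1/2} B((c - log k)/h)` of
`Literature/NumberTheory/LFunctions/WeilCombNodeWeightsDense.lean`.  According to the size of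
`y = nℓ'k'` one term falls in one of four ranges (`0 < h ≤ 1/(32L)`, `1 ≤ ℓ, ℓ' ≤ L`):

* `node_term_sparse` — SPARSE `y ≤ 1/(4h)`: the term is `B(0) (√ℓ/√ℓ') 𝟙[ℓ ∣ nℓ'k']/(n k')`;
* `node_term_dense` — DENSE INTERIOR `1/(4h) < y`, `y e^{2h} ≤ ℓM`: the term is
  `h β_h √ℓ'/√ℓ + O(L²/(h n² k'²))`, `β_h = ∫ B(v) e^{-hv/2} dv`;
* `node_term_edge` — EDGE `1/(4h) < y` (window possibly cut by `k ≤ M`, `B ≥ 0`): the term lies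
  between `0` and the same quantity;
* `node_term_beyond` — BEYOND `ℓ M e^{2h} < y`: the term vanishes.

Everything is proved; no named facts.
-/

noncomputable section

open MeasureTheory Set

namespace Literature.NumberTheory.LFunctions

section Term

variable {B B' B'' : ℝ → ℝ} {N₀ N₁ N₂ h : ℝ} {L n ℓ ℓ' k' M : ℕ}

/-- Size facts for `x = nℓ'k'/ℓ` in the dense ranges `1/(4h) < nℓ'k'`, `h ≤ 1/(32L)`:
`x > 0`, `1/(4L) ≤ h x`, `4 ≤ x e^{-2h}`, `nk'/L ≤ x`. [folklore] -/
theorem node_x_facts (hL : 1 ≤ L) (hℓ : 1 ≤ ℓ) (hℓL : ℓ ≤ L) (hℓ' : 1 ≤ ℓ')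
    (hh : 0 < h) (hhL : h ≤ 1 / (32 * L)) (hlow : 1 / (4 * h) < (n : ℝ) * ℓ' * k') :
    0 < (n : ℝ) * ℓ' * k' / ℓ ∧ 1 / (4 * L) ≤ h * ((n : ℝ) * ℓ' * k' / ℓ) ∧
      4 ≤ Real.exp (Real.log ((n : ℝ) * ℓ' * k' / ℓ) - 2 * h) ∧
      (n : ℝ) * k' / L ≤ (n : ℝ) * ℓ' * k' / ℓ := by
  have hLR : (1 : ℝ) ≤ L := by exact_mod_cast hL
  have hℓR : (1 : ℝ) ≤ ℓ := by exact_mod_cast hℓ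
  have hℓLR : (ℓ : ℝ) ≤ L := by exact_mod_cast hℓL
  have hℓ'R : (1 : ℝ) ≤ ℓ' := by exact_mod_cast hℓ'
  have hL0 : (0 : ℝ) < L := by linarith
  have hℓ0 : (0 : ℝ) < ℓ := by linarith
  have hy0 : 0 < (n : ℝ) * ℓ' * k' := lt_trans (by positivity) hlow
  set x : ℝ := (n : ℝ) * ℓ' * k' / ℓ with hx
  have hx0 : 0 < x := by positivity
  -- `h x ≥ 1/(4L)`
  have hhx : 1 / (4 * L) ≤ h * x := by
    have h1 : 1 / (4 * h) / ℓ < x := by rw [hx]; exact div_lt_div_of_pos_right hlow hℓ0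
    have h2 : 1 / (4 * L) ≤ h * (1 / (4 * h) / ℓ) := by
      rw [show h * (1 / (4 * h) / ℓ) = 1 / (4 * ℓ) by field_simp]
      exact one_div_le_one_div_of_le (by positivity) (by linarith)
    nlinarith
  refine ⟨hx0, hhx, ?_, ?_⟩
  · -- `x e^{-2h} ≥ (8/h·…)`: `x ≥ 1/(4hL) ≥ 8`, `e^{-2h} ≥ 1/2`
    rw [Real.exp_sub, Real.exp_log hx0]
    have hx8 : 8 ≤ x := by
      have : 1 / (4 * L) / h ≤ x := by
        rw [div_le_iff₀ hh]; linarith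
      have h8 : 8 ≤ 1 / (4 * L) / h := by
        rw [le_div_iff₀ hh, le_div_iff₀ (by positivity)]
        have := mul_le_mul_of_nonneg_left hhL (by norm_num : (0 : ℝ) ≤ 32 * L)
        rw [show 32 * (L : ℝ) * (1 / (32 * L)) = 1 by field_simp] at this
        nlinarith
      linarith
    have he : Real.exp (2 * h) ≤ 2 := by
      have hx1 : |2 * h| ≤ 1 := by
        rw [abs_of_pos (by linarith)]
        have : (L : ℝ)⁻¹ ≤ 1 := inv_le_one_of_one_le₀ hLR
        have : 1 / (32 * (L : ℝ)) ≤ 1 / 32 := one_div_le_one_div_of_le (by norm_num) (by linarith)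
        linarith
      have := Real.abs_exp_sub_one_sub_id_le hx1
      have hb := (abs_le.1 this).2
      have : 1 / (32 * (L : ℝ)) ≤ 1 / 32 := one_div_le_one_div_of_le (by norm_num) (by linarith)
      nlinarith
    rw [le_div_iff₀ (Real.exp_pos _)]
    nlinarith
  · rw [hx]
    rw [div_le_div_iff₀ hL0 hℓ0]
    have : (n : ℝ) * k' * ℓ ≤ (n : ℝ) * k' * L := mul_le_mul_of_nonneg_left hℓLR (by positivity)
    nlinarith [mul_le_mul_of_nonneg_left hℓ'R (by positivity : (0 : ℝ) ≤ (n : ℝ) * k' * L)]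

/-- Scaling of the dense-regime error by the weights `k'^{-1/2} n^{-1/2}`:
`C (x √x)^{-1}/h / s ≤ C L²/(h q²)` when `q²/L² ≤ x √x s`. [folklore] -/
theorem node_err_le {x C h L q s : ℝ} (hL : 1 ≤ L) (hq : 0 < q) (hxq : q / L ≤ x) (hC : 0 ≤ C)
    (hh : 0 < h) (hs : 0 < s) (hw : q ^ 2 / L ^ 2 ≤ x * Real.sqrt x * s) :
    C * (x⁻¹ * (Real.sqrt x)⁻¹) / h / s ≤ C * L ^ 2 / (h * q ^ 2) := by
  have hL0 : 0 < L := by linarith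
  have hx0 : 0 < x := lt_of_lt_of_le (by positivity) hxq
  have hsx : 0 < Real.sqrt x := Real.sqrt_pos.2 hx0
  have hpos : 0 < x * Real.sqrt x * s := by positivity
  have hqL : 0 < q ^ 2 / L ^ 2 := by positivity
  calc C * (x⁻¹ * (Real.sqrt x)⁻¹) / h / s = C / h * (1 / (x * Real.sqrt x * s)) := by
        field_simp
    _ ≤ C / h * (1 / (q ^ 2 / L ^ 2)) :=
        mul_le_mul_of_nonneg_left (one_div_le_one_div_of_le hqL hw) (by positivity)
    _ = C * L ^ 2 / (h * q ^ 2) := by field_simp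

/-- **DENSE INTERIOR term.** For `1/(4h) < nℓ'k'` and `nℓ'k' e^{2h} ≤ ℓ M` (`1 ≤ ℓ ≤ L`, `1 ≤ ℓ'`,
`n, k' ≥ 1`, `0 < h ≤ 1/(32L)`):
`|S(log(nℓ'k'/ℓ))/(√k'√n) - h β_h √ℓ'/√ℓ| ≤ (N₀+2N₁+N₂)(96+192L) L²/(h (n k')²)`. [folklore] -/
theorem node_term_dense
    (hB : ∀ x, HasDerivAt B (B' x) x) (hB' : ∀ x, HasDerivAt B' (B'' x) x)
    (h0 : ∀ x, |B x| ≤ N₀) (h1 : ∀ x, |B' x| ≤ N₁) (h2 : ∀ x, |B'' x| ≤ N₂)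
    (hBs : ∀ x, 2 < |x| → B x = 0)
    (hL : 1 ≤ L) (hℓ : 1 ≤ ℓ) (hℓL : ℓ ≤ L) (hℓ' : 1 ≤ ℓ') (hn : 1 ≤ n) (hk' : 1 ≤ k')
    (hh : 0 < h) (hhL : h ≤ 1 / (32 * L)) (hlow : 1 / (4 * h) < (n : ℝ) * ℓ' * k')
    (hup : (n : ℝ) * ℓ' * k' * Real.exp (2 * h) ≤ ℓ * M) :
    |(∑ k ∈ Finset.Icc 1 M, B ((Real.log ((n : ℝ) * ℓ' * k' / ℓ) - Real.log k) / h) / Real.sqrt k)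
          / Real.sqrt k' / Real.sqrt n
        - h * (∫ v, B v * Real.exp (-(h * v) / 2)) * (Real.sqrt ℓ' / Real.sqrt ℓ)|
      ≤ (N₀ + 2 * N₁ + N₂) * (96 + 192 * L) * L ^ 2 / (h * ((n : ℝ) * k') ^ 2) := by
  have hN₀ : 0 ≤ N₀ := (abs_nonneg _).trans (h0 0)
  have hN₁ : 0 ≤ N₁ := (abs_nonneg _).trans (h1 0)
  have hN₂ : 0 ≤ N₂ := (abs_nonneg _).trans (h2 0)
  obtain ⟨hx0, hhx, hx4, hxq⟩ := node_x_facts hL hℓ hℓL hℓ' hh hhL hlow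
  have hLR : (1 : ℝ) ≤ L := by exact_mod_cast hL
  have hℓR : (1 : ℝ) ≤ ℓ := by exact_mod_cast hℓ
  have hℓ0 : (0 : ℝ) < ℓ := by linarith
  have hnR : (1 : ℝ) ≤ n := by exact_mod_cast hn
  have hk'R : (1 : ℝ) ≤ k' := by exact_mod_cast hk'
  set x : ℝ := (n : ℝ) * ℓ' * k' / ℓ with hx
  set c : ℝ := Real.log x with hc
  have hexpc : Real.exp c = x := by rw [hc, Real.exp_log hx0]
  have h32 : 1 / (32 * (L : ℝ)) ≤ 1 / 32 := one_div_le_one_div_of_le (by norm_num) (by linarith)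
  have hh4 : h ≤ 1 / 4 := by linarith
  set c₀ : ℝ := 1 / (4 * L) with hc₀def
  have hc₀ : 0 < c₀ := by positivity
  have hc₀h : c₀ ≤ h * Real.exp c := by rw [hexpc]; exact hhx
  have hKM : Real.exp (c + 2 * h) ≤ M := by
    rw [Real.exp_add, hexpc, hx, div_mul_eq_mul_div, div_le_iff₀ hℓ0]
    calc (n : ℝ) * ℓ' * k' * Real.exp (2 * h) ≤ ℓ * M := hup
      _ = M * ℓ := mul_comm _ _
  have hd := abs_toothSum_sub_main_le (K := M) hB hB' h0 h1 h2 hBs hh hh4 hc₀ hc₀h hx4 hKM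
  have hC : (N₀ + 2 * N₁ + N₂) * (96 + 48 / c₀) = (N₀ + 2 * N₁ + N₂) * (96 + 192 * L) := by
    rw [hc₀def]; congr 1; field_simp; ring
  rw [hC] at hd
  -- square roots
  have hsx : Real.sqrt x = Real.sqrt n * Real.sqrt k' * (Real.sqrt ℓ' / Real.sqrt ℓ) := by
    rw [hx, Real.sqrt_div' _ hℓ0.le, Real.sqrt_mul (by positivity), Real.sqrt_mul n.cast_nonneg]
    ring
  have hexp2 : Real.exp (c / 2) = Real.sqrt x := by
    rw [hc, ← Real.log_sqrt hx0.le, Real.exp_log (Real.sqrt_pos.2 hx0)]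
  have hexp3 : Real.exp (-(3 * c / 2)) = x⁻¹ * (Real.sqrt x)⁻¹ := by
    rw [show -(3 * c / 2) = -c + -(c / 2) by ring, Real.exp_add, Real.exp_neg, Real.exp_neg, hexpc,
      hexp2]
  have hsk : 0 < Real.sqrt (k' : ℝ) := Real.sqrt_pos.2 (by linarith)
  have hsn : 0 < Real.sqrt (n : ℝ) := Real.sqrt_pos.2 (by linarith)
  have hsℓ : 0 < Real.sqrt (ℓ : ℝ) := Real.sqrt_pos.2 hℓ0
  set S := ∑ k ∈ Finset.Icc 1 M, B ((c - Real.log k) / h) / Real.sqrt k with hS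
  set β := ∫ v, B v * Real.exp (-(h * v) / 2) with hβ
  have hdiff : S / Real.sqrt k' / Real.sqrt n - h * β * (Real.sqrt ℓ' / Real.sqrt ℓ)
      = (S - h * Real.exp (c / 2) * β) / (Real.sqrt k' * Real.sqrt n) := by
    rw [hexp2, hsx]
    field_simp
  rw [hdiff, abs_div, abs_of_pos (mul_pos hsk hsn)]
  have hq : 0 < (n : ℝ) * k' := by positivity
  have hw := sq_div_sq_le_mul_sqrt hLR hq hxq
  have hsq : Real.sqrt ((n : ℝ) * k') = Real.sqrt k' * Real.sqrt n := by
    rw [Real.sqrt_mul n.cast_nonneg, mul_comm]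
  rw [hsq] at hw
  calc |S - h * Real.exp (c / 2) * β| / (Real.sqrt k' * Real.sqrt n)
      ≤ (N₀ + 2 * N₁ + N₂) * (96 + 192 * L) * Real.exp (-(3 * c / 2)) / h
          / (Real.sqrt k' * Real.sqrt n) := div_le_div_of_nonneg_right hd (mul_pos hsk hsn).le
    _ ≤ (N₀ + 2 * N₁ + N₂) * (96 + 192 * L) * L ^ 2 / (h * ((n : ℝ) * k') ^ 2) := by
        rw [hexp3]
        exact node_err_le hLR hq hxq (by positivity) hh (mul_pos hsk hsn) hw

/-- **EDGE term** (`B ≥ 0`, window possibly cut at `k = M`): for `1/(4h) < nℓ'k'`,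
`0 ≤ S(log(nℓ'k'/ℓ))/(√k'√n) ≤ h β_h √ℓ'/√ℓ + (N₀+2N₁+N₂)(96+192L) L²/(h (n k')²)`. [folklore] -/
theorem node_term_edge
    (hB : ∀ x, HasDerivAt B (B' x) x) (hB' : ∀ x, HasDerivAt B' (B'' x) x)
    (h0 : ∀ x, |B x| ≤ N₀) (h1 : ∀ x, |B' x| ≤ N₁) (h2 : ∀ x, |B'' x| ≤ N₂)
    (hBs : ∀ x, 2 < |x| → B x = 0) (hB0 : ∀ x, 0 ≤ B x)
    (hL : 1 ≤ L) (hℓ : 1 ≤ ℓ) (hℓL : ℓ ≤ L) (hℓ' : 1 ≤ ℓ') (hn : 1 ≤ n) (hk' : 1 ≤ k')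
    (hh : 0 < h) (hhL : h ≤ 1 / (32 * L)) (hlow : 1 / (4 * h) < (n : ℝ) * ℓ' * k') :
    0 ≤ (∑ k ∈ Finset.Icc 1 M, B ((Real.log ((n : ℝ) * ℓ' * k' / ℓ) - Real.log k) / h) / Real.sqrt k)
          / Real.sqrt k' / Real.sqrt n ∧
    (∑ k ∈ Finset.Icc 1 M, B ((Real.log ((n : ℝ) * ℓ' * k' / ℓ) - Real.log k) / h) / Real.sqrt k)
          / Real.sqrt k' / Real.sqrt n
      ≤ h * (∫ v, B v * Real.exp (-(h * v) / 2)) * (Real.sqrt ℓ' / Real.sqrt ℓ)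
        + (N₀ + 2 * N₁ + N₂) * (96 + 192 * L) * L ^ 2 / (h * ((n : ℝ) * k') ^ 2) := by
  have hN₀ : 0 ≤ N₀ := (abs_nonneg _).trans (h0 0)
  have hN₁ : 0 ≤ N₁ := (abs_nonneg _).trans (h1 0)
  have hN₂ : 0 ≤ N₂ := (abs_nonneg _).trans (h2 0)
  obtain ⟨hx0, hhx, hx4, hxq⟩ := node_x_facts hL hℓ hℓL hℓ' hh hhL hlow
  have hLR : (1 : ℝ) ≤ L := by exact_mod_cast hL
  have hℓR : (1 : ℝ) ≤ ℓ := by exact_mod_cast hℓ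
  have hℓ0 : (0 : ℝ) < ℓ := by linarith
  have hnR : (1 : ℝ) ≤ n := by exact_mod_cast hn
  have hk'R : (1 : ℝ) ≤ k' := by exact_mod_cast hk'
  set x : ℝ := (n : ℝ) * ℓ' * k' / ℓ with hx
  set c : ℝ := Real.log x with hc
  have hexpc : Real.exp c = x := by rw [hc, Real.exp_log hx0]
  have h32 : 1 / (32 * (L : ℝ)) ≤ 1 / 32 := one_div_le_one_div_of_le (by norm_num) (by linarith)
  have hh4 : h ≤ 1 / 4 := by linarith
  set c₀ : ℝ := 1 / (4 * L) with hc₀def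
  have hc₀ : 0 < c₀ := by positivity
  have hc₀h : c₀ ≤ h * Real.exp c := by rw [hexpc]; exact hhx
  have hd := toothSum_le_main_add hB hB' h0 h1 h2 hBs hB0 hh hh4 hc₀ hc₀h hx4 M
  have hC : (N₀ + 2 * N₁ + N₂) * (96 + 48 / c₀) = (N₀ + 2 * N₁ + N₂) * (96 + 192 * L) := by
    rw [hc₀def]; congr 1; field_simp; ring
  rw [hC] at hd
  have hsx : Real.sqrt x = Real.sqrt n * Real.sqrt k' * (Real.sqrt ℓ' / Real.sqrt ℓ) := by
    rw [hx, Real.sqrt_div' _ hℓ0.le, Real.sqrt_mul (by positivity), Real.sqrt_mul n.cast_nonneg]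
    ring
  have hexp2 : Real.exp (c / 2) = Real.sqrt x := by
    rw [hc, ← Real.log_sqrt hx0.le, Real.exp_log (Real.sqrt_pos.2 hx0)]
  have hexp3 : Real.exp (-(3 * c / 2)) = x⁻¹ * (Real.sqrt x)⁻¹ := by
    rw [show -(3 * c / 2) = -c + -(c / 2) by ring, Real.exp_add, Real.exp_neg, Real.exp_neg, hexpc,
      hexp2]
  have hsk : 0 < Real.sqrt (k' : ℝ) := Real.sqrt_pos.2 (by linarith)
  have hsn : 0 < Real.sqrt (n : ℝ) := Real.sqrt_pos.2 (by linarith)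
  have hsℓ : 0 < Real.sqrt (ℓ : ℝ) := Real.sqrt_pos.2 hℓ0
  set S := ∑ k ∈ Finset.Icc 1 M, B ((c - Real.log k) / h) / Real.sqrt k with hS
  set β := ∫ v, B v * Real.exp (-(h * v) / 2) with hβ
  have hS0 : 0 ≤ S := toothSum_nonneg hB0 h c M
  refine ⟨by positivity, ?_⟩
  have hq : 0 < (n : ℝ) * k' := by positivity
  have hw := sq_div_sq_le_mul_sqrt hLR hq hxq
  have hsq : Real.sqrt ((n : ℝ) * k') = Real.sqrt k' * Real.sqrt n := by
    rw [Real.sqrt_mul n.cast_nonneg, mul_comm]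
  rw [hsq] at hw
  have herr := node_err_le (C := (N₀ + 2 * N₁ + N₂) * (96 + 192 * L)) hLR hq hxq (by positivity) hh
    (mul_pos hsk hsn) hw
  -- divide `hd` by `√k' √n`
  have hmain : h * Real.exp (c / 2) * β / Real.sqrt k' / Real.sqrt n
      = h * β * (Real.sqrt ℓ' / Real.sqrt ℓ) := by
    rw [hexp2, hsx]; field_simp
  calc S / Real.sqrt k' / Real.sqrt n
      ≤ (h * Real.exp (c / 2) * β
          + (N₀ + 2 * N₁ + N₂) * (96 + 192 * L) * Real.exp (-(3 * c / 2)) / h)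
            / Real.sqrt k' / Real.sqrt n :=
        div_le_div_of_nonneg_right (div_le_div_of_nonneg_right hd hsk.le) hsn.le
    _ = h * β * (Real.sqrt ℓ' / Real.sqrt ℓ)
          + (N₀ + 2 * N₁ + N₂) * (96 + 192 * L) * (x⁻¹ * (Real.sqrt x)⁻¹) / h
            / (Real.sqrt k' * Real.sqrt n) := by
        rw [add_div, add_div, hmain, hexp3, div_div]
    _ ≤ _ := by linarith [herr]

/-- **SPARSE term.** For `nℓ'k' ≤ 1/(4h)` (`0 < h < 1/4`, `nℓ'k' ≤ M`):
`S(log(nℓ'k'/ℓ))/(√k'√n) = B(0) (√ℓ/√ℓ') 𝟙[ℓ ∣ nℓ'k']/(k' n)`. [folklore] -/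
theorem node_term_sparse (hBs : ∀ x, 2 < |x| → B x = 0) (hh : 0 < h) (hh4 : h < 1 / 4)
    (hℓ : 1 ≤ ℓ) (hℓ' : 1 ≤ ℓ') (hn : 1 ≤ n) (hk' : 1 ≤ k')
    (hlow : (n : ℝ) * ℓ' * k' ≤ 1 / (4 * h)) (hM : n * ℓ' * k' ≤ M) :
    (∑ k ∈ Finset.Icc 1 M, B ((Real.log ((n : ℝ) * ℓ' * k' / ℓ) - Real.log k) / h) / Real.sqrt k)
          / Real.sqrt k' / Real.sqrt n
      = B 0 * (Real.sqrt ℓ / Real.sqrt ℓ') * (if ℓ ∣ n * ℓ' * k' then 1 / (k' : ℝ) else 0) / n := by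
  have hℓR : (1 : ℝ) ≤ ℓ := by exact_mod_cast hℓ
  have hℓ'R : (1 : ℝ) ≤ ℓ' := by exact_mod_cast hℓ'
  have hℓ0 : (0 : ℝ) < ℓ := by linarith
  have hnR : (1 : ℝ) ≤ n := by exact_mod_cast hn
  have hk'R : (1 : ℝ) ≤ k' := by exact_mod_cast hk'
  have hy : 1 ≤ n * ℓ' * k' := Nat.mul_pos (Nat.mul_pos hn hℓ') hk'
  have hcast : ((n * ℓ' * k' : ℕ) : ℝ) = (n : ℝ) * ℓ' * k' := by push_cast; ring
  have hyh : 2 * h * (((n * ℓ' * k' : ℕ) : ℝ) + 1) < 1 := by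
    rw [hcast]
    have h1 : 2 * h * ((n : ℝ) * ℓ' * k') ≤ 2 * h * (1 / (4 * h)) :=
      mul_le_mul_of_nonneg_left hlow (by linarith)
    rw [show 2 * h * (1 / (4 * h)) = 1 / 2 by field_simp; ring] at h1
    nlinarith
  have hsp := toothSum_sparse hBs hh hy hℓ hyh hM
  rw [hcast] at hsp
  rw [hsp]
  have hsk : 0 < Real.sqrt (k' : ℝ) := Real.sqrt_pos.2 (by linarith)
  have hsn : 0 < Real.sqrt (n : ℝ) := Real.sqrt_pos.2 (by linarith)
  have hsℓ : 0 < Real.sqrt (ℓ : ℝ) := Real.sqrt_pos.2 hℓ0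
  have hsℓ' : 0 < Real.sqrt (ℓ' : ℝ) := Real.sqrt_pos.2 (by linarith)
  split_ifs with hdvd
  · have hprod := sqrt_node_mul (n := n) (ℓ' := ℓ') (k' := k') hℓ
    rw [div_div, div_div, ← mul_assoc, hprod]
    field_simp
  · simp

/-- **BEYOND the edge.** If `ℓ M e^{2h} < nℓ'k'` the term vanishes. [folklore] -/
theorem node_term_beyond (hBs : ∀ x, 2 < |x| → B x = 0) (hh : 0 < h) (hℓ : 1 ≤ ℓ)
    (hbeyond : (ℓ : ℝ) * M * Real.exp (2 * h) < (n : ℝ) * ℓ' * k') :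
    (∑ k ∈ Finset.Icc 1 M, B ((Real.log ((n : ℝ) * ℓ' * k' / ℓ) - Real.log k) / h) / Real.sqrt k)
          / Real.sqrt k' / Real.sqrt n = 0 := by
  have hℓ0 : (0 : ℝ) < ℓ := by exact_mod_cast hℓ
  have hx0 : 0 < (n : ℝ) * ℓ' * k' / ℓ := by
    have : 0 < (n : ℝ) * ℓ' * k' := lt_of_le_of_lt (by positivity) hbeyond
    positivity
  have hlt : (M : ℝ) < Real.exp (Real.log ((n : ℝ) * ℓ' * k' / ℓ) - 2 * h) := by
    rw [Real.exp_sub, Real.exp_log hx0, lt_div_iff₀ (Real.exp_pos _), lt_div_iff₀ hℓ0]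
    calc (M : ℝ) * Real.exp (2 * h) * ℓ = ℓ * M * Real.exp (2 * h) := by ring
      _ < (n : ℝ) * ℓ' * k' := hbeyond
  rw [toothSum_eq_zero_of_lt hBs hh hlt, zero_div, zero_div]

end Term

end Literature.NumberTheory.LFunctions
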